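import Summits.QuantumFields.YangMills.Theorems.LangevinControlUVOSLegsFromFemtoAndGapDefs
import Summits.QuantumFields.YangMills.Theses.BalabanLadder
import Summits.QuantumFields.YangMills.Theorems.SoloBlindLatticeGapEndpoints
import Summits.QuantumFields.YangMills.Theorems.IR.BetaSlopeFloorTransport
import Summits.QuantumFields.YangMills.Theorems.IR.BetaSlopeFloorSpeciesToPairs
import Summits.QuantumFields.YangMills.Theorems.IR.BetaSlopeFloorTransportRunning
import Summits.QuantumFields.YangMills.Theorems.IR.BetaSlopeFloorTransportSignFree
import Summits.QuantumFields.YangMills.Theorems.IR.BetaSlopeFloorSliceRefl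
import Summits.QuantumFields.YangMills.Theorems.IR.BetaSlopeFloorRungStrongCouplingTwo
import Summits.QuantumFields.YangMills.Theorems.IR.BetaSlopeFloorTransportGuarded
import Summits.QuantumFields.YangMills.Theorems.IR.SCFloorSlopeLaw
import Literature.MathematicalPhysics.QuantumLattice.WilsonBlockHeatBathLightCone2
import Literature.MathematicalPhysics.QuantumFieldTheory.SpeciesTimeReflection
/-!
# Line `beta-slope-floor` for crux `IR` (stmt-QuantumFields-19354, route BalabanLadder) — ideator ym-ir-idea-2 (lens: correlation-inequality hunt)
# Skeleton v6 (lead prover ym-ir-line-bsf-p1 g4, 2026-08-28, on v5.1): (i) the XL load is RE-TYPED to its GUARDED form `stub_reflSlopeFloorPos` — the running floor is asked only where the reflected antipodal clause is POSITIVE (v5.1's unguarded `ReflSlopeFloor` is over-strong: for an eventually NEGATIVE clause `R_b = −ε_b`, `ε_b ≍ e^{−M_A(b)S}` with the asymptotically-free sign `∂_b M_A < 0`, it forces `c·a(b) ≥ |∂_b M_A(b)|` as `S → ∞`, the reverse of what positive clauses force, so it pins `c·a(b) = |∂_b(a·m)(b)|` and fails for a sign reason unrelated to the gap; the guarded form is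 strictly weaker — `reflSlopeFloorPos_of_reflSlopeFloor` — and is what the Feynman–Hellmann heuristic supports); the composition is unchanged thanks to the new guarded transport `BetaSlopeFloor.reflAntipodalDecay_of_windowRegular_of_guardedFloor` (`Theorems/IR/BetaSlopeFloorTransportGuarded.lean`, p613899: fencing `e^{−l₀(x−β)}R` from below; no sign, no upper unit bound); (ii) rung census: the instance `n = 1`, `A =` plaquette of the volume-uniform rung is CLOSED with the sharp coefficient `4/b` (`SCFloor.rung_strongCoupling_uniform_plaquette_one`, `SCFloor.facingPlaquetteCorr_logSlope`, `Theorems/IR/SCFloorSlopeLaw{Estimate,}.lean`, p612978/p613474, on the `β⁴` law p606286) — cited as `stub_rung_strongCoupling_uniform_one_closed`.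
# Skeleton v5.1 (lead prover ym-ir-line-bsf-p1 g2, 2026-08-28, on the ideator's v4): the strong-coupling rung is RE-TYPED POINTWISE (uniformity in the volume = tube re-expansion, census) and CLOSED BY NAME (`BetaSlopeFloor.stub_rung_strongCoupling`, p594987, order of vanishing, `Theorems/IR/BetaSlopeFloorRung*.lean`); v4 = §5 ADOPTED — the XL load is the REFLECTED running slope floor over ALL species (`stub_reflSlopeFloor`); `stub_windowRegularity` is a DECLARED RESIDUAL HYPOTHESIS (width 0)

**Lever (one object).** The β-SLOPE of a reflection-paired time correlator on the odd torus `(2S+1)⁴`,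
`R_b(A; S) := latticeConnectedCorr r.ρ b (2S+1) ΘA A S` (and its co-clause `A, ΘA`), `ΘA = A.timeReflect`.
On a finite torus `∂_b ⟨F⟩_b = Cov_b(S_W, F)` (`S_W` = total Wilson action) is an exact identity
(`BetaSlopeFloor.hasDerivAt_latticeConnectedCorr`, p587735), so a FLOOR on the slope,
`(c·a(b)·S − K_A)·R_b ≤ ∂_b R_b` for `b ∈ [β, β+1]`, is a three-observable correlation inequality
`Cov_b(S_W ; ΘĀ·Ā_S) ≥ (c a(b) S − K_A)·⟨ΘĀ·Ā_S⟩_b` — a quantitative Griffiths-II-in-β whose constant RUNS with the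
unit.  Transport over the unit window needs NO sign (sign-free fencing lemma, p589353) and is anchored at the free
end by the a-priori bound `|R_{β+1}| ≤ 2‖A‖∞²`: ANY positive floor constant `c` yields reflected antipodal decay at
rate `(cκ)·a(β)`, and the tree's part-12 reflection-positivity reduction (p588079) turns that into `GapInUnits` for
all pairs.  No door, no boundary datum, no cell, no class-reduction debt.

**v6 composition (`IR_of`, concludes `BalabanLadder.IR` BY NAME):**
`stub_windowRegularity` (DECLARED RESIDUAL, XL-in-disguise, width 0) → `stub_reflSlopeFloorPos` (THE XL LOAD, GUARDED,
consumes simplicity of `G`) → `reflAntipodalDecay_of_windowRegular_of_reflSlopeFloorPos` (PROVED, p613899) →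
`stub_speciesToPairs_closed` (PROVED, p588079).  `IR` is therefore closed modulo EXACTLY TWO sorried statements, both
of gap strength: {`stub_windowRegularity`, `stub_reflSlopeFloorPos`}; `irCal_of_hypotheses` records the same implication
with the two loads as explicit hypotheses and no `sorry` (`irCal_of_hypotheses_unguarded`: the v5.1 loads still
suffice, being stronger).  Sorried stubs after v6: `stub_windowRegularity` (residual), `stub_reflSlopeFloorPos` (XL).
Closed by name: `stub_rung_strongCoupling` (v5 pointwise rung, p594987), `stub_rung_strongCoupling_uniform_one` (v6,
volume-uniform at `n = 1` for the plaquette, p613474), `stub_gronwall` (p589159 ← p587735; library),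
`stub_speciesToPairs` (p588079).

**Why v4 (answers on file).**
* Lead bsf-p1 (00:27/00:31Z, seat closed): `stub_sliceToSpecies : SliceDiagDecay → ReflAntipodalDecay` is NOT
  provable as typed (β-uniform per-species constants do not follow from density / the Markov–OS identity; the tree has
  no transfer-matrix spectral theorem) — option (γ) adopted: the XL step is stated directly for the reflected antipodal
  clauses of every species; the slice floor `SlopeFloor` survives only as the slice special case
  (`reflSlopeFloor_on_slices_of_slopeFloor`, with `BetaSlopeFloor.timeReflect_F_of_isSliceObs`, p588719) and as the
  statement of the strong-coupling rung.
* crit-1 (00:14:47Z): `LowerBounds` carries floors at the ONE scale `a(β)` and no upper-scale information, so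
  `LowerBounds → WindowRegular a` needs `ξ(β+1) ≤ C·ξ(β)`-type input = clustering = XL-in-disguise.  Accepted: the stub
  is carried as a DECLARED RESIDUAL HYPOTHESIS with no supplier (director 00:27:04Z: width 0 like the load).  It stays
  POINTWISE (`κ·a(β) ≤ a(b)` on unit windows): the landed transport helpers consume exactly this form; the integral
  weakening `∫_β^{β+1} a ≥ κ·a(β)` would need a measurability binder on the unit (junk `∫` otherwise, checklist 4c(ii))
  and a new transport lemma, and is no less XL — recorded in the card as admissible re-typing R-INT, not adopted.
* critics' P3(i)/R362(c) («every mode with weight must run at the AF rate»): the antipodal index `S` with `S ≥ S₁(β)`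
  means only CHANNEL BOTTOMS must run (`−∂_b E₀^{(A)}(b) ≥ c·a(b)`); heavier scaling states run faster in absolute
  terms and cutoff-scale states (`E = O(1)`) are exponentially sub-dominant at the antipode; `K_A` absorbs
  `∂_b log`(overlaps).  False for non-simple `G` (photon factor: slope `−2/b`; lopsided `SU(2)×SU(2)`: slope `∝ a₂ ≪ a`)
  — a proof must consume `hG`.
* History: rev 1 (dcec8fec) frozen unit; rev 2/2b (53adc9c7/120cd766) running unit + `stub_windowRegularity`; lead v2/v3/
  v3.1 (0bba99ee/…/329b5ff3) closed `stub_gronwall`, split `stub_classReduction` into 3a (flagged) + 3b (closed), proved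
  the sign-free transport and wrote §5; v4 (this file) promotes §5 to the registered composition.

Rung (v5, lead g2): the v1–v4 rung asked for `β_sc = β_sc(G, r)` and `K = K_A` UNIFORM in the torus `S` and the
separation `n ≤ S`; that uniformity is the `b`-derivative of the strong-coupling glueball mass uniformly in `n` (a
convergent tube re-expansion `D_b = b^m e^{n h_S(b)} k_{A,S}(b)`, Montvay–Münster (3.439)–(3.440), Osterwalder–Seiler
1978 §3 / Schor 1983–84), for which the tree's PROVED OS78 machinery gives upper bounds/analyticity only — census row,
oversized for a rung (`stub-misstated: uniformity`).  The rung is therefore RE-TYPED POINTWISE in `(A, S, n)`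
(`stub_rung_strongCoupling` below: `∀ A S n, ∃ K β_sc`), which is PROVED (`Theorems/IR/BetaSlopeFloorRungStrongCouplingTwo.lean`,
by name; route: doubling identity `Z² D_b = ∫ F (G − G') e^{−b(S_W + S_W')}` over two product-Haar copies, vanishing of
the doubled Haar moments below order `2n` by a slab-swap ⊕ skew-Haar-translation symmetry, hence ORDER OF VANISHING
`≥ 2n` of `b ↦ D_b(S, A, n)` at `b = 0`, plus the RP sign `D_b ≥ 0` and an analytic slope-floor lemma).  HONESTY: nothing here proves the Yang–Mills mass gap (Clay); `stub_reflSlopeFloor` and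
`stub_windowRegularity` are open statements of gap strength with no rigorous supplier; R4 closes only the conditional
finite-𝕋⁴ rung `BalabanLadder.UV`.
-/

noncomputable section

open Filter Topology MeasureTheory
open Literature.MathematicalPhysics.QuantumFieldTheory Literature.MathematicalPhysics.QuantumLattice
open Summit.QuantumFields.YangMills.Cruxes.OSLegsFromFemtoAndGap.DlrCollarTransfer (GapInUnits LowerBounds)

namespace Summit.QuantumFields.YangMills.Cruxes.IR.BetaSlopeFloor

/-! ## §1 Objects -/

section Defs

variable {G : Type} [Group G] [TopologicalSpace G] [IsTopologicalGroup G] [CompactSpace G]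
  [MeasurableSpace G] [BorelSpace G]

/-- A time-zero spatial ("slice") species: supported on spatial links of the time-zero slice (the class of
`SoloBlind.latticeConnectedCorr_self_logConvex/antitone/nonneg`). -/
def IsSliceObs (A : YMSpecies G) : Prop := ∀ e ∈ A.supp, e.1 0 = 0 ∧ e.2 ≠ 0

/-- The reflection-positive diagonal time correlator `D_b(A; S, n)` on the odd torus `(ℤ/(2S+1))⁴`. -/
def diagCorr (r : LatticeRep G) (b : ℝ) (S : ℕ) (A : YMSpecies G) (n : ℕ) : ℝ :=
  latticeConnectedCorr r.ρ b (2 * S + 1) A.F A.F n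

/-- **(W) WINDOW REGULARITY of the unit** (rev 2; the critics' "silent hypothesis", typed): the unit does not drop
by more than a factor `κ` inside any unit window beyond `β₂`: `κ·a(β) ≤ a(b)` for `b ∈ [β, β+1]`. -/
def WindowRegular (a : ℝ → ℝ) : Prop :=
  ∃ κ β₂ : ℝ, 0 < κ ∧ ∀ β : ℝ, β₂ ≤ β → ∀ b : ℝ, β ≤ b → b ≤ β + 1 → κ * a β ≤ a b

/-- **(L1) β-SLOPE FLOOR** (the lever, derivative form; rev 2: the unit RUNS with `b`).  For every slice species `A`
there is `K_A` such that on every unit window `b ∈ [β, β+1]`, `β ≥ β₂`, on all large tori `S ≥ S₁(β)` and all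
`n ≤ S`: `(c·a(b)·n − K_A) · D_b(A;S,n) ≤ ∂_b D_b(A;S,n)`.  Equivalently (exact lattice identity
`∂_b⟨F⟩_b = Cov_b(S_W, F)`): the total Wilson action is positively correlated with the pair product `Ā·τₙĀ`,
super-linearly in the separation `n` measured in physical units.  (`deriv` of the differentiable map
`b ↦ D_b`, `BetaSlopeFloor.hasDerivAt_latticeConnectedCorr`; no junk value arises.) -/
def SlopeFloor (r : LatticeRep G) (a : ℝ → ℝ) : Prop :=
  ∃ (c β₂ : ℝ) (S₁ : ℝ → ℕ), 0 < c ∧ ∀ A : YMSpecies G, IsSliceObs A → ∃ K : ℝ,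
    ∀ β : ℝ, β₂ ≤ β → ∀ S n : ℕ, S₁ β ≤ S → n ≤ S → ∀ b : ℝ, β ≤ b → b ≤ β + 1 →
      (c * a b * n - K) * diagCorr r b S A n ≤ deriv (fun b' => diagCorr r b' S A n) b

/-- **(L2) WINDOW DOMINATION** (integrated form): `D_β(n) ≤ K_A · e^{−c a(β) n} · D_{β+1}(n)`. -/
def WindowDomination (r : LatticeRep G) (a : ℝ → ℝ) : Prop :=
  ∃ (c β₂ : ℝ) (S₁ : ℝ → ℕ), 0 < c ∧ ∀ A : YMSpecies G, IsSliceObs A → ∃ K : ℝ,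
    ∀ β : ℝ, β₂ ≤ β → ∀ S n : ℕ, S₁ β ≤ S → n ≤ S →
      diagCorr r β S A n ≤ K * Real.exp (-(c * a β * n)) * diagCorr r (β + 1) S A n

/-- **(L3) SLICE-DIAGONAL DECAY IN UNITS**: `GapInUnits` restricted to the diagonal pairs `(A, A)` of slice species. -/
def SliceDiagDecay (r : LatticeRep G) (a : ℝ → ℝ) : Prop :=
  ∃ (c₁ β₂ : ℝ) (S₁ : ℝ → ℕ), 0 < c₁ ∧ ∀ A : YMSpecies G, IsSliceObs A → ∃ C : ℝ,
    ∀ β : ℝ, β₂ ≤ β → ∀ S n : ℕ, S₁ β ≤ S → n ≤ S →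
      diagCorr r β S A n ≤ C * Real.exp (-(c₁ * a β * n))

/-- The first REFLECTED antipodal clause `c_{ΘA,A}(S; S)` of a species on the odd torus `(2S+1)⁴`
(`ΘA = A.timeReflect`, site time reflection; tree `SoloBlindClusteringReflected`). -/
def reflCorr (r : LatticeRep G) (b : ℝ) (S : ℕ) (A : YMSpecies G) : ℝ :=
  latticeConnectedCorr r.ρ b (2 * S + 1) A.timeReflect.F A.F S

/-- The second reflected antipodal clause `c_{A,ΘA}(S; S)`. -/
def coreflCorr (r : LatticeRep G) (b : ℝ) (S : ℕ) (A : YMSpecies G) : ℝ :=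
  latticeConnectedCorr r.ρ b (2 * S + 1) A.F A.timeReflect.F S

/-- **(L3′) REFLECTED ANTIPODAL DECAY IN UNITS** of EVERY species (the hypothesis the tree's part-12 reduction
consumes): `c_{ΘA,A}(S;S), c_{A,ΘA}(S;S) ≤ C_A e^{−c₁ a(β) S}` for `β ≥ β₂`, `S ≥ S₁ β`. -/
def ReflAntipodalDecay (r : LatticeRep G) (a : ℝ → ℝ) : Prop :=
  ∃ (c₁ β₂ : ℝ) (S₁ : ℝ → ℕ), 0 < c₁ ∧ ∀ A : YMSpecies G, ∃ C : ℝ, ∀ β : ℝ, β₂ ≤ β →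
    ∀ S : ℕ, S₁ β ≤ S →
      reflCorr r β S A ≤ C * Real.exp (-(c₁ * a β * S)) ∧
        coreflCorr r β S A ≤ C * Real.exp (-(c₁ * a β * S))

/-- **(L1′) REFLECTED β-SLOPE FLOOR** (the lever over ALL species, antipodal index only, unit running with `b` — the
recommended re-typing of the XL stub, §5): for every species `A` a constant `K_A` with
`(c·a(b)·S − K_A) · R_b ≤ ∂_b R_b` on `b ∈ [β, β+1]` for both reflected antipodal clauses `R = c_{ΘA,A}(S;S)`,
`c_{A,ΘA}(S;S)`, `β ≥ β₂`, `S ≥ S₁ β`. -/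
def ReflSlopeFloor (r : LatticeRep G) (a : ℝ → ℝ) : Prop :=
  ∃ (c β₂ : ℝ) (S₁ : ℝ → ℕ), 0 < c ∧ ∀ A : YMSpecies G, ∃ K : ℝ, ∀ β : ℝ, β₂ ≤ β → ∀ S : ℕ, S₁ β ≤ S →
    ∀ b : ℝ, β ≤ b → b ≤ β + 1 →
      (c * a b * S - K) * reflCorr r b S A ≤ deriv (fun b' => reflCorr r b' S A) b ∧
        (c * a b * S - K) * coreflCorr r b S A ≤ deriv (fun b' => coreflCorr r b' S A) b

/-- **(L1″) GUARDED REFLECTED β-SLOPE FLOOR** (v6: THE XL LOAD).  As (L1′), but the running floor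
`(c·a(b)·S − K_A)·R_b ≤ ∂_b R_b` is asked for each reflected antipodal clause only AT THE POINTS `b` WHERE THAT CLAUSE
IS POSITIVE.  Strictly weaker than (L1′) (`reflSlopeFloorPos_of_reflSlopeFloor`); immune to the sign objection (a
negative clause decaying at an asymptotically-free running rate violates (L1′) for large `S`); transported to decay by
`BetaSlopeFloor.reflAntipodalDecay_of_windowRegular_of_guardedFloor` (p613899). -/
def ReflSlopeFloorPos (r : LatticeRep G) (a : ℝ → ℝ) : Prop :=
  ∃ (c β₂ : ℝ) (S₁ : ℝ → ℕ), 0 < c ∧ ∀ A : YMSpecies G, ∃ K : ℝ, ∀ β : ℝ, β₂ ≤ β → ∀ S : ℕ, S₁ β ≤ S →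
    ∀ b : ℝ, β ≤ b → b ≤ β + 1 →
      (0 < reflCorr r b S A → (c * a b * S - K) * reflCorr r b S A ≤ deriv (fun b' => reflCorr r b' S A) b) ∧
        (0 < coreflCorr r b S A →
          (c * a b * S - K) * coreflCorr r b S A ≤ deriv (fun b' => coreflCorr r b' S A) b)

/-- **(L2′) REFLECTED WINDOW DOMINATION** (integrated form, frozen unit; §5 option B — the card's (S-c) "window-
integrated" typing, the quantity a reweighting/MC engine measures): both reflected antipodal clauses at `β` are
dominated by `K_A e^{−c a(β) S}` times the same clause at `β + 1`.  Weaker than (W)+(L1′) (proved below). -/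
def ReflWindowDomination (r : LatticeRep G) (a : ℝ → ℝ) : Prop :=
  ∃ (c β₂ : ℝ) (S₁ : ℝ → ℕ), 0 < c ∧ ∀ A : YMSpecies G, ∃ K : ℝ, ∀ β : ℝ, β₂ ≤ β → ∀ S : ℕ, S₁ β ≤ S →
    reflCorr r β S A ≤ K * Real.exp (-(c * a β * S)) * reflCorr r (β + 1) S A ∧
      coreflCorr r β S A ≤ K * Real.exp (-(c * a β * S)) * coreflCorr r (β + 1) S A

end Defs

/-! ## §2 Proved seams: window domination + the free a-priori bound ⇒ slice decay; running reflected floor ⇒ reflected decay -/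

section Seam

variable {G : Type} [Group G] [TopologicalSpace G] [IsTopologicalGroup G] [CompactSpace G]
  [MeasurableSpace G] [BorelSpace G]

/-- Anchoring at the trivial end: `D_{β+1}(n) ≤ 2‖A‖∞²` (the torus Wilson state is a probability measure), so
window domination gives `D_β(n) ≤ |K_A|·2‖A‖∞²·e^{−c a(β) n}` for ALL `n ≤ S`. (PROVED.) -/
theorem sliceDiagDecay_of_windowDomination (r : LatticeRep G) (a : ℝ → ℝ) (h : WindowDomination r a) :
    SliceDiagDecay r a := by
  obtain ⟨c, β₂, S₁, hc, hA⟩ := h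
  refine ⟨c, β₂, S₁, hc, fun A hsl => ?_⟩
  obtain ⟨K, hK⟩ := hA A hsl
  obtain ⟨CA, hCA⟩ := A.bounded
  refine ⟨|K| * (2 * (CA * CA)), fun β hβ S n hS hn => ?_⟩
  have h1 := hK β hβ S n hS hn
  have h2 : |diagCorr r (β + 1) S A n| ≤ 2 * (CA * CA) :=
    WilsonBlockHeatBath.abs_latticeConnectedCorr_le_two_mul r (β + 1) (2 * S + 1) hCA hCA n
  have hexp : 0 ≤ Real.exp (-(c * a β * n)) := (Real.exp_pos _).le
  calc diagCorr r β S A n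
      ≤ K * Real.exp (-(c * a β * n)) * diagCorr r (β + 1) S A n := h1
    _ ≤ |K * Real.exp (-(c * a β * n)) * diagCorr r (β + 1) S A n| := le_abs_self _
    _ = |K| * Real.exp (-(c * a β * n)) * |diagCorr r (β + 1) S A n| := by
        rw [abs_mul, abs_mul, abs_of_nonneg hexp]
    _ ≤ |K| * Real.exp (-(c * a β * n)) * (2 * (CA * CA)) := by
        gcongr
    _ = |K| * (2 * (CA * CA)) * Real.exp (-(c * a β * n)) := by ring

/-- A window-domination inequality plus the free bound `|c_{β+1}| ≤ M` gives `c_β ≤ |K| M e^{−x}`. -/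
private theorem decay_of_window {x K cβ cβ1 M : ℝ} (h1 : cβ ≤ K * Real.exp (-x) * cβ1) (h2 : |cβ1| ≤ M) :
    cβ ≤ |K| * M * Real.exp (-x) := by
  have hexp : 0 ≤ Real.exp (-x) := (Real.exp_pos _).le
  calc cβ ≤ K * Real.exp (-x) * cβ1 := h1
    _ ≤ |K * Real.exp (-x) * cβ1| := le_abs_self _
    _ = |K| * Real.exp (-x) * |cβ1| := by rw [abs_mul, abs_mul, abs_of_nonneg hexp]
    _ ≤ |K| * Real.exp (-x) * M := by gcongr
    _ = |K| * M * Real.exp (-x) := by ring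

/-- **Option B seam (PROVED):** reflected window domination (integrated form, frozen unit) + the free anchor
`|c_{ΘA,A}(S;S)|, |c_{A,ΘA}(S;S)| ≤ 2‖A‖∞²` at `β + 1` ⇒ reflected antipodal decay at the same rate. -/
theorem reflAntipodalDecay_of_reflWindowDomination (r : LatticeRep G) (a : ℝ → ℝ)
    (h : ReflWindowDomination r a) : ReflAntipodalDecay r a := by
  obtain ⟨c, β₂, S₁, hc, hA⟩ := h
  refine ⟨c, β₂, S₁, hc, fun A => ?_⟩
  obtain ⟨K, hK⟩ := hA A
  obtain ⟨CA, hCA⟩ := A.bounded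
  have hCA' : ∀ U, |A.timeReflect.F U| ≤ CA := fun U => by simpa using hCA (cfgReflect U)
  refine ⟨|K| * (2 * (CA * CA)), fun β hβ S hS => ?_⟩
  obtain ⟨h1, h2⟩ := hK β hβ S hS
  exact ⟨decay_of_window h1
      (WilsonBlockHeatBath.abs_latticeConnectedCorr_le_two_mul r (β + 1) (2 * S + 1) hCA' hCA S),
    decay_of_window h2
      (WilsonBlockHeatBath.abs_latticeConnectedCorr_le_two_mul r (β + 1) (2 * S + 1) hCA hCA' S)⟩

/-- **Consistency of the re-typing on the critics' class (PROVED):** on SLICE species the re-typed floor (L1′) is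
implied by the filed floor (L1) at the antipodal index, because a slice species is fixed by the site time reflection
(`BetaSlopeFloor.timeReflect_F_of_isSliceObs`, p588719): for the same `c, β₂, S₁, K_A`. -/
theorem reflSlopeFloor_on_slices_of_slopeFloor (r : LatticeRep G) (a : ℝ → ℝ) (h : SlopeFloor r a) :
    ∃ (c β₂ : ℝ) (S₁ : ℝ → ℕ), 0 < c ∧ ∀ A : YMSpecies G, IsSliceObs A → ∃ K : ℝ, ∀ β : ℝ, β₂ ≤ β →
      ∀ S : ℕ, S₁ β ≤ S → ∀ b : ℝ, β ≤ b → b ≤ β + 1 →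
        (c * a b * S - K) * reflCorr r b S A ≤ deriv (fun b' => reflCorr r b' S A) b ∧
          (c * a b * S - K) * coreflCorr r b S A ≤ deriv (fun b' => coreflCorr r b' S A) b := by
  obtain ⟨c, β₂, S₁, hc, h⟩ := h
  refine ⟨c, β₂, S₁, hc, fun A hA => ?_⟩
  obtain ⟨K, hK⟩ := h A hA
  refine ⟨K, fun β hβ S hS b hb1 hb2 => ?_⟩
  have h1 := hK β hβ S S hS le_rfl b hb1 hb2
  simp only [reflCorr, coreflCorr, diagCorr, timeReflect_F_of_isSliceObs A hA] at h1 ⊢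
  exact ⟨h1, h1⟩

/-- **Reflected decay from the running reflected floor (PROVED, sign-free):** window regularity + `ReflSlopeFloor`
give `ReflAntipodalDecay` at rate `c·κ` — by the landed
`BetaSlopeFloor.reflAntipodalDecay_of_windowRegular_of_runningFloor` (`Theorems/IR/BetaSlopeFloorTransportSignFree.lean`,
p589353: no-downward-crossing fencing lemma, Feynman–Hellmann differentiability, free anchor `2‖A‖∞²` at `β+1`;
no reflection-positivity sign is used). Definitional unfolding only. -/
theorem reflAntipodalDecay_of_windowRegular_of_reflSlopeFloor (r : LatticeRep G) (a : ℝ → ℝ)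
    (hW : WindowRegular a) (h : ReflSlopeFloor r a) : ReflAntipodalDecay r a :=
  reflAntipodalDecay_of_windowRegular_of_runningFloor r a hW h

/-- **v6 seam (PROVED): reflected decay from the GUARDED running reflected floor.**  Window regularity +
`ReflSlopeFloorPos` give `ReflAntipodalDecay` at rate `c·κ` — by the landed
`BetaSlopeFloor.reflAntipodalDecay_of_windowRegular_of_guardedFloor` (`Theorems/IR/BetaSlopeFloorTransportGuarded.lean`,
p613899: if a clause is positive at `β`, the function `e^{−l₀(b−β)}·R_b` cannot fall below its value at `β` anywhere on
the window — at a first contact with a lower barrier the clause is still positive, so the guarded floor applies — hence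
`R_β ≤ e^{−l₀}·R_{β+1} ≤ e^{−l₀}·2‖A‖∞²`; if it is non-positive at `β` the bound is free).  Definitional unfolding only. -/
theorem reflAntipodalDecay_of_windowRegular_of_reflSlopeFloorPos (r : LatticeRep G) (a : ℝ → ℝ)
    (hW : WindowRegular a) (h : ReflSlopeFloorPos r a) : ReflAntipodalDecay r a :=
  reflAntipodalDecay_of_windowRegular_of_guardedFloor r a hW h

/-- **The v6 re-typing is a weakening (PROVED):** the unguarded floor (L1′) implies the guarded floor (L1″) with the
same constants (`BetaSlopeFloor.guarded_of_unguarded`). -/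
theorem reflSlopeFloorPos_of_reflSlopeFloor (r : LatticeRep G) (a : ℝ → ℝ) (h : ReflSlopeFloor r a) :
    ReflSlopeFloorPos r a :=
  guarded_of_unguarded r a h

end Seam

/-! ## §3 Registered stubs -/

/-- **STUB 0 — WINDOW REGULARITY OF THE CALIBRATED UNIT — DECLARED RESIDUAL HYPOTHESIS (v4; XL-in-disguise, width 0,
no supplier; crit-1 2026-08-28T00:14:47Z, director 00:27:04Z).**  For compact simple `G`, every `r`, every admissible
unit `a` calibrated by `LowerBounds`: `κ·a(β) ≤ a(b)` on unit windows beyond `β₂`.  Why it is NOT an L-sized lemma: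
`LowerBounds` pins the unit from ONE side at ONE scale per `β` (the `Q2`/`Q3` floors at spacing `a(β)` forbid
`a(β)⁻¹ ≫ ξ(β)` only through clustering, and say nothing about `a(b)` for `b ≠ β`); regularity across the window needs
`ξ(β+1) ≤ C·ξ(β)` — information of the same strength as the gap.  Why plausibly true: asymptotic freedom makes `ξ` grow
by a bounded factor per unit `β` and every unit calibrated by non-trivial physics is `≍ 1/ξ`.  Why it might fail: an
admissible unit may oscillate by unbounded factors on unit windows if the bare floors also hold off-scale — then this
stub is false AND `IR` as typed is false for that unit (a finding about the LEAF's typing, route-owner question on the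
desk).  Pointwise form kept: it is exactly what the landed transport (p589353) consumes.  NOT group-blind. -/
theorem stub_windowRegularity : ∀ (G : Type) [Group G] [TopologicalSpace G] [IsTopologicalGroup G]
    [CompactSpace G], IsCompactSimpleLieGroup G → letI : MeasurableSpace G := borel G;
    haveI : BorelSpace G := ⟨rfl⟩;
    ∀ (r : LatticeRep G) (a : ℝ → ℝ), (∀ β, 0 < a β) → Tendsto a atTop (𝓝 0) →
      LowerBounds G r a → WindowRegular a := by
  sorry

/-- **STUB 1″ — THE GUARDED REFLECTED β-SLOPE FLOOR OVER ALL SPECIES (v6: THE XL LOAD; crux-level; consumes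
simplicity of `G`; running unit; antipodal index only; floor asked only where the clause is positive).**  For compact
simple `G`, every `r`, every admissible unit `a` calibrated by `LowerBounds`: `ReflSlopeFloorPos r a` (L1″) — for every
species `A` a constant `K_A` with `(c·a(b)·S − K_A)·R_b ≤ ∂_b R_b` at every `b ∈ [β, β+1]` WHERE `R_b > 0`, `β ≥ β₂`,
`S ≥ S₁ β`, for both reflected antipodal clauses.  As a correlation inequality: `Cov_b(S_W ; ΘĀ·Ā_S) ≥
(c·a(b)·S − K_A)·⟨ΘĀ ; Ā_S⟩_b` whenever `⟨ΘĀ ; Ā_S⟩_b > 0` (exact identity `∂_b⟨F⟩ = Cov_b(S_W,F)`).  v6 vs v5.1: the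
unguarded (L1′) also constrained NEGATIVE clauses, where for `R_b = −ε_b`, `ε_b ≍ e^{−M_A(b)S}`, `∂_b M_A < 0`, it
demands `c·a(b) ≥ |∂_b M_A(b)|` — the reverse of the positive-clause requirement — an over-statement unrelated to
the gap; (L1″) drops exactly that.
Why plausibly true: Feynman–Hellmann on the transfer matrix, `∂_b log R_b(S) → −S·∂_b E₀^{(A)}(b) + O(1)`, and under
scaling every channel bottom is `E₀^{(A)} = λ_A·m_phys·a(b)`, `λ_A ≥ 1`, so `−∂_b E₀^{(A)} = s(b)·E₀^{(A)} ≥ s·m_phys·a(b)`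
(`s = −d log a/db > 0` by asymptotic freedom; physics anchor: Michael's lattice action sum rule `−dm/dβ = ⟨S_W⟩_{1−0}`,
trace anomaly).  Only channel bottoms must run (antipodal index); `K_A` absorbs overlap derivatives.  Why it might fail:
FALSE for non-simple `G` (photon factor: slope `−2/b`, no growth in `S`; lopsided `SU(2)×SU(2)`: slope `∝ a₂ ≪ a`), so a
proof must consume `hG`; at fixed `b` in a Coulomb-like phase it fails — it IS of gap strength (XL, no rigorous supplier
known; none of GKS/FKG applies: `Literature.Barriers.QuantumFields.ToronPlaneAnticorrelation`).  Cheapest falsifier: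
MC covariance slope `R_β(S)` vs `S` at Wilson `β_W ∈ [2.3, 2.5]`, `12⁴/16⁴` (un-run, MC-class). -/
theorem stub_reflSlopeFloorPos : ∀ (G : Type) [Group G] [TopologicalSpace G] [IsTopologicalGroup G]
    [CompactSpace G], IsCompactSimpleLieGroup G → letI : MeasurableSpace G := borel G; haveI : BorelSpace G := ⟨rfl⟩;
    ∀ (r : LatticeRep G) (a : ℝ → ℝ), (∀ β, 0 < a β) → Tendsto a atTop (𝓝 0) →
      LowerBounds G r a → ReflSlopeFloorPos r a := by
  sorry

/-- **STUB 2 — GRÖNWALL ON THE UNIT WINDOW (rev 2, M) — CLOSED BY NAME** (`BetaSlopeFloor.stub_gronwall_running`,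
tree `Theorems/IR/BetaSlopeFloorTransportRunning.lean`, p589159, on top of `Theorems/IR/BetaSlopeFloorTransport.lean`,
p587735).  v4: library — the slice special case; no longer on the `IR_of` path. -/
theorem stub_gronwall_closed : ∀ (G : Type) [Group G] [TopologicalSpace G] [IsTopologicalGroup G]
    [CompactSpace G] [MeasurableSpace G] [BorelSpace G] (r : LatticeRep G) (a : ℝ → ℝ), (∀ β, 0 < a β) →
      WindowRegular a → SlopeFloor r a → WindowDomination r a :=
  fun G _ _ _ _ _ _ r a ha hW h => stub_gronwall_running G r a ha hW h

/-- **STUB 3b — SPECIES ⇒ ALL PAIRS (M; reflection positivity / OS Schwarz / log-convexity, group-blind) — CLOSED BY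
NAME** (`BetaSlopeFloor.stub_speciesToPairs`, tree `Theorems/IR/BetaSlopeFloorSpeciesToPairs.lean`, p588079: the
tree's rung-D8 part-12 reduction `SoloBlind.exists_const_abs_latticeConnectedCorr_le` made uniform in the rate
`c₁ a(β) ≤ c₁`, plus the trivial bound on tori smaller than the pair's slab heights).  `Tendsto a atTop (𝓝 0)` is one
of `IR`'s hypotheses and is needed for β-free constants. -/
theorem stub_speciesToPairs_closed : ∀ (G : Type) [Group G] [TopologicalSpace G] [IsTopologicalGroup G]
    [CompactSpace G] [MeasurableSpace G] [BorelSpace G] (r : LatticeRep G) (a : ℝ → ℝ), (∀ β, 0 < a β) →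
      Tendsto a atTop (𝓝 0) → ReflAntipodalDecay r a → GapInUnits G r a :=
  fun G _ _ _ _ _ _ r a ha ha0 h => stub_speciesToPairs G r a ha ha0 h

/-- **STUB 4 — STRONG-COUPLING RUNG (BC5 format; NOT used by `IR_of`; group-blind, as a rung may be) — v5: POINTWISE
in `(A, S, n)` — CLOSED BY NAME** (`BetaSlopeFloor.stub_rung_strongCoupling`, tree
`Theorems/IR/BetaSlopeFloorRungStrongCouplingTwo.lean`, p594987; the registered v5 signature restated, cited here as
`stub_rung_strongCoupling_closed`).  For every compact `G`, every rep `r`, every slice species `A` (`IsSliceObs`,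
δ-unfolded), every odd torus `(2S+1)⁴`, `S ≥ 1`, and every separation `n ≤ S` there are `K` and `β_sc > 0` with
`(2n/b − K)·D_b(n) ≤ ∂_b D_b(n)` for `0 < b ≤ β_sc` (`D_b(n) = diagCorr r b S A n`, δ-unfolded).  Mechanism: at `b = 0`
(Haar) the doubled connected moments `∫ A(U)(τₙA(U) − τₙA(U'))(S_W(U)+S_W(U'))^j` vanish for `j < 2n` — a `j`-tuple of
plaquettes leaves a forward and a backward time step with at most one timelike plaquette, and the slab swap of the two
copies composed with four skew Haar translations is a measure-preserving symmetry under which the integrand is odd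
(`integral_doubledMoment_eq_zero_two`) — so `D_b(n)` vanishes to order `≥ 2n` at `b = 0`
(`le_analyticOrderAt_latticeConnectedCorr_two`); with `D_b ≥ 0` (reflection positivity) the floor follows
(`exists_slope_floor_of_le_analyticOrderAt`).  (The true order is `4n` on tori of side `≥ 5`: the lightest
strong-coupling excitation is a tube of `4n` plaquettes, `m(b) = −4 log b + …`.)  The v1–v4 form (`β_sc`, `K_A`
uniform in `S, n`) is the census row «tube re-expansion», not claimed. -/
theorem stub_rung_strongCoupling_closed : ∀ (G : Type) [Group G] [TopologicalSpace G] [IsTopologicalGroup G]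
    [CompactSpace G] [MeasurableSpace G] [BorelSpace G] (r : LatticeRep G) (A : YMSpecies G),
      IsSliceObs A → ∀ S n : ℕ, 1 ≤ S → n ≤ S →
        ∃ K βsc : ℝ, 0 < βsc ∧ ∀ b : ℝ, 0 < b → b ≤ βsc →
          (2 * n / b - K) * diagCorr r b S A n ≤ deriv (fun b' => diagCorr r b' S A n) b :=
  fun G _ _ _ _ _ _ r A hA S n hS hn => stub_rung_strongCoupling G r A hA S n hS hn

/-- **STUB 4⁺ — THE STRONG-COUPLING RUNG AT `n = 1` FOR THE PLAQUETTE, UNIFORMLY IN THE VOLUME (v6) — CLOSED BY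
NAME** (`SCFloor.rung_strongCoupling_uniform_plaquette_one`, tree `Theorems/IR/SCFloorSlopeLaw.lean`, p613474; engine
parts 21–22 on top of the volume-uniform `β⁴` law `SCFloor.facingPlaquetteCorr_floor`, p606286).  For every compact
simple Lie `G` and every `r` there are `K` and `β_sc > 0` INDEPENDENT OF THE TORUS with `(2·1/b − K)·D_b ≤ ∂_b D_b`
for all odd tori `(2S+1)⁴`, `S ≥ 1`, and all `0 < b ≤ β_sc`, `D_b = diagCorr r b S A 1` for the plaquette species
(`A.F = plaquetteObs r.ρ 0 1 2`, a time-zero slice species; δ-unfolded).  In fact `|∂_b log D_b − 4/b| ≤ K` uniformly in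
the volume (`SCFloor.facingPlaquetteCorr_logSlope_latticeRep`: the tube of four lateral plaquettes).  Method:
holomorphy of the torus plaquette system on the strong-coupling disc with a volume-uniform bound (Osterwalder–Seiler),
order `≥ 5` of `D − J b⁴`, Schwarz lemma with multiplicity on the complex disc, Cauchy estimate for the derivative.
The census row «tube re-expansion» (uniformity in `S` AND `n`) stays open for `n ≥ 2`. -/
theorem stub_rung_strongCoupling_uniform_one_closed : ∀ (G : Type) [Group G] [TopologicalSpace G]
    [IsTopologicalGroup G] [CompactSpace G], IsCompactSimpleLieGroup G →
    letI : MeasurableSpace G := borel G; haveI : BorelSpace G := ⟨rfl⟩;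
    ∀ (r : LatticeRep G), ∃ K βsc : ℝ, 0 < βsc ∧ ∀ S : ℕ, 1 ≤ S → ∀ b : ℝ, 0 < b → b ≤ βsc →
      (2 * (1 : ℕ) / b - K) *
          latticeConnectedCorr r.ρ b (2 * S + 1) (plaquetteObs r.ρ 0 1 2) (plaquetteObs r.ρ 0 1 2) 1 ≤
        deriv (fun b' =>
          latticeConnectedCorr r.ρ b' (2 * S + 1) (plaquetteObs r.ρ 0 1 2) (plaquetteObs r.ρ 0 1 2) 1) b :=
  SCFloor.rung_strongCoupling_uniform_plaquette_one

/-! ## §4 Composition — concludes the crux BY NAME -/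

/-- `IR`'s body verbatim (as in the registered line `birth.lean`), for the `delta` step. -/
def IRCal : Prop :=
  ∀ (G : Type) [Group G] [TopologicalSpace G] [IsTopologicalGroup G] [CompactSpace G],
    IsCompactSimpleLieGroup G → letI : MeasurableSpace G := borel G; haveI : BorelSpace G := ⟨rfl⟩;
    ∀ (r : LatticeRep G) (a : ℝ → ℝ), (∀ β, 0 < a β) → Tendsto a atTop (𝓝 0) →
      LowerBounds G r a → GapInUnits G r a

/-- **The two loads made explicit, no `sorry` (v6):** any supplier of window regularity and of the GUARDED reflected
running slope floor (both from `IR`'s hypotheses) yields `IR`'s body — guarded transport (p613899) + species ⇒ pairs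
(p588079). -/
theorem irCal_of_hypotheses
    (hW : ∀ (G : Type) [Group G] [TopologicalSpace G] [IsTopologicalGroup G] [CompactSpace G],
      IsCompactSimpleLieGroup G → letI : MeasurableSpace G := borel G; haveI : BorelSpace G := ⟨rfl⟩;
      ∀ (r : LatticeRep G) (a : ℝ → ℝ), (∀ β, 0 < a β) → Tendsto a atTop (𝓝 0) →
        LowerBounds G r a → WindowRegular a)
    (hXL : ∀ (G : Type) [Group G] [TopologicalSpace G] [IsTopologicalGroup G] [CompactSpace G],
      IsCompactSimpleLieGroup G → letI : MeasurableSpace G := borel G; haveI : BorelSpace G := ⟨rfl⟩;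
      ∀ (r : LatticeRep G) (a : ℝ → ℝ), (∀ β, 0 < a β) → Tendsto a atTop (𝓝 0) →
        LowerBounds G r a → ReflSlopeFloorPos r a) : IRCal := by
  intro G _ _ _ _ hG
  letI : MeasurableSpace G := borel G
  haveI : BorelSpace G := ⟨rfl⟩
  intro r a ha ha0 hLB
  have h0 : WindowRegular a := hW G hG r a ha ha0 hLB
  have h1 : ReflSlopeFloorPos r a := hXL G hG r a ha ha0 hLB
  have h3 : ReflAntipodalDecay r a := reflAntipodalDecay_of_windowRegular_of_reflSlopeFloorPos r a h0 h1
  exact stub_speciesToPairs_closed G r a ha ha0 h3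

/-- The v5.1 (unguarded) loads still suffice, being stronger (`reflSlopeFloorPos_of_reflSlopeFloor`). -/
theorem irCal_of_hypotheses_unguarded
    (hW : ∀ (G : Type) [Group G] [TopologicalSpace G] [IsTopologicalGroup G] [CompactSpace G],
      IsCompactSimpleLieGroup G → letI : MeasurableSpace G := borel G; haveI : BorelSpace G := ⟨rfl⟩;
      ∀ (r : LatticeRep G) (a : ℝ → ℝ), (∀ β, 0 < a β) → Tendsto a atTop (𝓝 0) →
        LowerBounds G r a → WindowRegular a)
    (hXL : ∀ (G : Type) [Group G] [TopologicalSpace G] [IsTopologicalGroup G] [CompactSpace G],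
      IsCompactSimpleLieGroup G → letI : MeasurableSpace G := borel G; haveI : BorelSpace G := ⟨rfl⟩;
      ∀ (r : LatticeRep G) (a : ℝ → ℝ), (∀ β, 0 < a β) → Tendsto a atTop (𝓝 0) →
        LowerBounds G r a → ReflSlopeFloor r a) : IRCal :=
  irCal_of_hypotheses hW fun G _ _ _ _ hG => by
    letI : MeasurableSpace G := borel G
    haveI : BorelSpace G := ⟨rfl⟩
    intro r a ha ha0 hLB
    exact reflSlopeFloorPos_of_reflSlopeFloor r a (hXL G hG r a ha ha0 hLB)

/-- v6 composition from the stubs. -/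
theorem irCal_of_stubs : IRCal :=
  irCal_of_hypotheses (fun G _ _ _ _ hG => stub_windowRegularity G hG)
    (fun G _ _ _ _ hG => stub_reflSlopeFloorPos G hG)

/-- **The line concludes the crux by name.** `IR_of` consumes exactly the open stubs {`stub_windowRegularity`
(declared residual), `stub_reflSlopeFloorPos` (XL, guarded)}, the proved seam
`reflAntipodalDecay_of_windowRegular_of_reflSlopeFloorPos` (p613899) and the closed `stub_speciesToPairs` (p588079). -/
theorem IR_of : Summit.QuantumFields.YangMills.Theses.BalabanLadder.IR := by
  have h : IRCal := irCal_of_stubs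
  delta Summit.QuantumFields.YangMills.Theses.BalabanLadder.IR
  delta Summit.QuantumFields.YangMills.Cruxes.IR.BetaSlopeFloor.IRCal at h
  exact h

/-! ## §5 Alternative typings of the load (PROVED implications, not registered stubs) -/

/-- **Option B: `IR` from reflected window domination alone** (integrated form, frozen unit; no window-regularity
hypothesis because the unit is read at the left end — the regularity is then part of the claim, not silent): the
card's (S-c) typing, for a reweighting/MC engine (ratio of the two reflected antipodal clauses at `β` and `β+1`). -/
theorem irCal_of_reflWindowDomination
    (hXL : ∀ (G : Type) [Group G] [TopologicalSpace G] [IsTopologicalGroup G] [CompactSpace G],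
      IsCompactSimpleLieGroup G → letI : MeasurableSpace G := borel G; haveI : BorelSpace G := ⟨rfl⟩;
      ∀ (r : LatticeRep G) (a : ℝ → ℝ), (∀ β, 0 < a β) → Tendsto a atTop (𝓝 0) →
        LowerBounds G r a → ReflWindowDomination r a) : IRCal := by
  intro G _ _ _ _ hG
  letI : MeasurableSpace G := borel G
  haveI : BorelSpace G := ⟨rfl⟩
  intro r a ha ha0 hLB
  have h3 : ReflAntipodalDecay r a := reflAntipodalDecay_of_reflWindowDomination r a (hXL G hG r a ha ha0 hLB)
  exact stub_speciesToPairs_closed G r a ha ha0 h3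

/-- **Option S (slice special case, library):** window regularity + the SLICE floor `SlopeFloor` give decay in units of
all slice-diagonal correlators (`SliceDiagDecay`) — closed (p589159, p587735); this no longer reaches `IR` (the flagged
`SliceDiagDecay → ReflAntipodalDecay` left the line in v4) but is the statement the strong-coupling rung instantiates. -/
theorem sliceDiagDecay_of_windowRegular_of_slopeFloor {G : Type} [Group G] [TopologicalSpace G]
    [IsTopologicalGroup G] [CompactSpace G] [MeasurableSpace G] [BorelSpace G] (r : LatticeRep G) (a : ℝ → ℝ)
    (ha : ∀ β, 0 < a β) (hW : WindowRegular a) (h : SlopeFloor r a) : SliceDiagDecay r a :=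
  sliceDiagDecay_of_windowDomination r a (stub_gronwall_closed G r a ha hW h)

end Summit.QuantumFields.YangMills.Cruxes.IR.BetaSlopeFloor

end
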